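import Literature.MathematicalPhysics.KineticTheory.ReyBelletThomas2002Proofs
import Literature.MathematicalPhysics.KineticTheory.LangevinChainHormander
import Literature.Analysis.Distribution.BracketGeneratingGerms
import HarnessLib

/-!
# Rey-Bellet–Thomas 2002, Proposition 4.1: Hörmander's bracket condition for the effective dynamics, PROVED

Topic `Literature/MathematicalPhysics/KineticTheory` (trunk T-KINETIC). Provefact unit for the
named fact `ReyBelletThomas2002_thm21` (`ReyBelletThomas2002.lean`, Rey-Bellet–Thomas 2002,
Theorem 2.1), second PROVED ingredient of its printed proof (§4, hypoellipticity ⇒ strong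
Feller): **Proposition 4.1** — "If **H2** holds then the generator `L` given by Eq. (13)
satisfies the rank condition (45)", i.e. writing `L = ∑_b X_b² + X₀` with
`X_L = √(γT_L) ∂_{r_L}`, `X_R = √(γT_R) ∂_{r_R}` and `X₀` the drift of (RBT-SDE), the iterated
Lie brackets of `{X₀, X_L, X_R}` span the tangent space at every point of the extended phase
space `X = RBPhaseSpace N` (`d = 1`, `N` sites, general smooth pinning `U = U⁽¹⁾` and a coupling
`V` (`= U⁽²⁾` up to `x ↦ -x`) satisfying the POINTWISE non-degeneracy **H2**:
`∀ q ∃ m ≥ 2, V⁽ᵐ⁾(q) ≠ 0`, `RBNondegenerate`).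

## The printed proof and its formalisation

RBT p. 26: "`[∂_{r₁}, X₀] = γ∂_{r₁} - λ∂_{p₁}`, `[[∂_{r₁}, X₀], X₀] = γ²∂_{r₁} - γλ∂_{p₁} - λ∂_{q₁}`
yield the vector fields `∂_{p₁}` and `∂_{q₁}`. Further
`[∂_{q₁}, X₀] = ∑ ∂²V ∂_{p₁} + ∑ ∂²U⁽²⁾(q₁ - q₂) ∂_{p₂}`. If `U⁽²⁾` is strictly convex, this
yields `∂_{p₂}` while in the general case we need to consider further the commutators
`[∂_{q₁}, [ ⋯, [∂_{q₁}, ∑ ∂²U⁽²⁾(q₁ - q₂) ∂_{p₂}]]] = ∑ ∂^{m+1}U⁽²⁾(q₁ - q₂) ∂_{p₂}`. The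
condition H2 means that we can write `∂_{p₂}` as a linear combination of these commutators for
every `x ∈ X`. The other basis elements of the tangent space are obtained inductively following
the same procedure." Two points the text glosses over are handled by the generic file
`Literature/Analysis/Distribution/BracketGeneratingGerms.lean`: (i) `∂_{q₁}` etc. are LINEAR
COMBINATIONS of iterated brackets, and brackets of such combinations are again combinations of
(right-nested) iterated brackets only thanks to the Jacobi identity (`lieSpan`,
`lieBracket_mem_lieSpan`); (ii) the coefficient `∂^m U⁽²⁾(q₁ - q₂)` vanishes at other points, so
"`∂_{p₂}` as a linear combination" holds with SMOOTH-FUNCTION coefficients NEAR the given point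
only — the germ `C^∞`-module `InGermModule … x₀`, which is closed under brackets and whose values
at `x₀` stay in Hörmander's span. With these, the induction over the sites `0, 1, …, N-1`
(`isBracketGenerating_rbHormanderFamily`, sweeping from the LEFT reservoir; the right one only
supplies `∂_{r_R}`) is literally the printed one: at site `i+1`, the fields
`Z_k = (-1)^k V⁽ᵏ⁾(q_{i+1} - q_i) ∂_{p_{i+1}}`, `k ≥ 2`, are in the germ module
(`Z_2 = [∂_{q_i}, X₀] - (known directions)`, `Z_{k+1} = [∂_{q_i}, Z_k]`), and H2 at `q_{i+1} - q_i`
picks `k` with a coefficient non-vanishing at the point.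

## Contents

* `rbUnitQ/rbUnitP/rbUnitRL/rbUnitRR`, `eq_sum_rbUnit` — coordinates of `RBPhaseSpace N`.
* `OscillatorChain.rbDrift P Λ N` — the drift `X₀` of (RBT-SDE) (`q̇ = p`, `ṗ = -∇_qV - Λᵀr`,
  `ṙ = -γr + Λp`), its closed form, smoothness, and derivatives along the coordinates
  (`fderiv_rbDrift_rbUnitRL/RR/P/Q`).
* `OscillatorChain.rbBathField`, `OscillatorChain.rbHormanderFamily` — `X_b = √(γT_b) ∂_{r_b}`
  and the family `(X₀, X_L, X_R)` indexed by `Option (Fin 2)`;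
  `rbGenerator_eq_hormanderOp`: `L f = ∑_b X_b(X_b f) + X₀ f` for `f ∈ C^∞` (`γT_L, γT_R ≥ 0`), so
  this IS the family of "the generator `L` given by Eq. (13)".
* `OscillatorChain.isBracketGenerating_rbHormanderFamily` — **RBT Prop. 4.1, PROVED**, for smooth
  `U, V`, `V` satisfying H2, `Λ ≠ 0`, `γT_L > 0`, `γT_R > 0`, any `N`.

## References

* L. Rey-Bellet, L. E. Thomas, *Exponential convergence to non-equilibrium stationary states in
  classical statistical mechanics*, Comm. Math. Phys. **225** (2002) 305–329
  (arXiv:math-ph/0110024), §2 eq. (13), §4 eq. (45) and Proposition 4.1 with its proof (p. 26).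
* L. Hörmander, Acta Math. **119** (1967) 147–171, Thm 1.1.
-/

noncomputable section

open Set Filter VectorField Finset Literature.Analysis.Distribution
open scoped ContDiff Topology

namespace Literature.MathematicalPhysics.KineticTheory.HeatConduction

variable {N : ℕ}

/-! ### Coordinates on the extended phase space -/

/-- The coordinate vector of the position `q_i` in `RBPhaseSpace N`. [folklore] -/
def rbUnitQ (i : Fin N) : RBPhaseSpace N := ((Pi.single i 1, 0), 0)

/-- The coordinate vector of the momentum `p_i` in `RBPhaseSpace N`. [folklore] -/
def rbUnitP (i : Fin N) : RBPhaseSpace N := ((0, Pi.single i 1), 0)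

/-- The coordinate vector of the left reservoir variable `r_L`. [folklore] -/
def rbUnitRL : RBPhaseSpace N := (0, (1, 0))

/-- The coordinate vector of the right reservoir variable `r_R`. [folklore] -/
def rbUnitRR : RBPhaseSpace N := (0, (0, 1))

/-- `rbUnitQ i` is the literal `((e_i, 0), 0)` of `ReyBelletThomas2002Proofs`. [folklore] -/
theorem rbUnitQ_eq (i : Fin N) : rbUnitQ i = (((Pi.single i 1, 0), 0) : RBPhaseSpace N) := rfl

/-- `rbUnitP i` is the literal `((0, e_i), 0)`. [folklore] -/
theorem rbUnitP_eq (i : Fin N) : rbUnitP i = (((0, Pi.single i 1), 0) : RBPhaseSpace N) := rfl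

/-- `rbUnitRL` is the literal `(0, (1, 0))`. [folklore] -/
theorem rbUnitRL_eq : (rbUnitRL : RBPhaseSpace N) = (0, (1, 0)) := rfl

/-- `rbUnitRR` is the literal `(0, (0, 1))`. [folklore] -/
theorem rbUnitRR_eq : (rbUnitRR : RBPhaseSpace N) = (0, (0, 1)) := rfl

/-- Expansion of a vector of the extended phase space in the coordinate vectors. [folklore] -/
theorem eq_sum_rbUnit (v : RBPhaseSpace N) :
    v = (∑ i, v.1.1 i • rbUnitQ i) + (∑ i, v.1.2 i • rbUnitP i) + v.2.1 • rbUnitRL +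
      v.2.2 • rbUnitRR := by
  refine Prod.ext (Prod.ext (funext fun j => ?_) (funext fun j => ?_)) (Prod.ext ?_ ?_) <;>
    simp [rbUnitQ, rbUnitP, rbUnitRL, rbUnitRR, Prod.fst_sum, Prod.snd_sum, Finset.sum_apply,
      Pi.single_apply]

/-- A continuous linear map out of the extended phase space is determined by its values on the
coordinate vectors. [folklore] -/
theorem clm_apply_eq_sum_rbUnit {F : Type*} [NormedAddCommGroup F] [NormedSpace ℝ F]
    (L : RBPhaseSpace N →L[ℝ] F) (v : RBPhaseSpace N) :
    L v = (∑ i, v.1.1 i • L (rbUnitQ i)) + (∑ i, v.1.2 i • L (rbUnitP i)) + v.2.1 • L rbUnitRL +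
      v.2.2 • L rbUnitRR := by
  conv_lhs => rw [eq_sum_rbUnit v]
  simp only [map_add, map_sum, map_smul]

/-- The coordinate vectors span the extended phase space. [folklore] -/
theorem span_rbUnit_eq_top (N : ℕ) :
    Submodule.span ℝ (Set.range (rbUnitQ (N := N)) ∪ Set.range (rbUnitP (N := N)) ∪
      {rbUnitRL, rbUnitRR}) = ⊤ := by
  rw [eq_top_iff]
  rintro v -
  set S := Set.range (rbUnitQ (N := N)) ∪ Set.range (rbUnitP (N := N)) ∪ {rbUnitRL, rbUnitRR}
  have hQ : ∀ i, rbUnitQ i ∈ Submodule.span ℝ S := fun i =>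
    Submodule.subset_span (Or.inl (Or.inl ⟨i, rfl⟩))
  have hP : ∀ i, rbUnitP i ∈ Submodule.span ℝ S := fun i =>
    Submodule.subset_span (Or.inl (Or.inr ⟨i, rfl⟩))
  have hL : rbUnitRL ∈ Submodule.span ℝ S := Submodule.subset_span (Or.inr (Or.inl rfl))
  have hR : rbUnitRR ∈ Submodule.span ℝ S := Submodule.subset_span (Or.inr (Or.inr rfl))
  rw [eq_sum_rbUnit v]
  exact Submodule.add_mem _ (Submodule.add_mem _ (Submodule.add_mem _
    (Submodule.sum_mem _ fun i _ => Submodule.smul_mem _ _ (hQ i))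
    (Submodule.sum_mem _ fun i _ => Submodule.smul_mem _ _ (hP i)))
    (Submodule.smul_mem _ _ hL)) (Submodule.smul_mem _ _ hR)

/-! ### Moving along the coordinate directions -/

section Moves

variable (x : RBPhaseSpace N) (t : ℝ)

/-- Component bookkeeping for moving along a coordinate direction (`add_smul_rbUnitQ_fst_fst`). [folklore] -/
@[simp] theorem add_smul_rbUnitQ_fst_fst (i : Fin N) :
    (x + t • rbUnitQ i).1.1 = x.1.1 + t • Pi.single i 1 := by simp [rbUnitQ]
/-- Component bookkeeping for moving along a coordinate direction (`add_smul_rbUnitQ_fst_snd`). [folklore] -/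
@[simp] theorem add_smul_rbUnitQ_fst_snd (i : Fin N) : (x + t • rbUnitQ i).1.2 = x.1.2 := by
  simp [rbUnitQ]
/-- Component bookkeeping for moving along a coordinate direction (`add_smul_rbUnitQ_snd`). [folklore] -/
@[simp] theorem add_smul_rbUnitQ_snd (i : Fin N) : (x + t • rbUnitQ i).2 = x.2 := by
  simp [rbUnitQ]
/-- Component bookkeeping for moving along a coordinate direction (`add_smul_rbUnitP_fst_fst`). [folklore] -/
@[simp] theorem add_smul_rbUnitP_fst_fst (i : Fin N) : (x + t • rbUnitP i).1.1 = x.1.1 := by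
  simp [rbUnitP]
/-- Component bookkeeping for moving along a coordinate direction (`add_smul_rbUnitP_fst_snd`). [folklore] -/
@[simp] theorem add_smul_rbUnitP_fst_snd (i : Fin N) :
    (x + t • rbUnitP i).1.2 = x.1.2 + t • Pi.single i 1 := by simp [rbUnitP]
/-- Component bookkeeping for moving along a coordinate direction (`add_smul_rbUnitP_snd`). [folklore] -/
@[simp] theorem add_smul_rbUnitP_snd (i : Fin N) : (x + t • rbUnitP i).2 = x.2 := by
  simp [rbUnitP]
/-- Component bookkeeping for moving along a coordinate direction (`add_smul_rbUnitRL_fst`). [folklore] -/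
@[simp] theorem add_smul_rbUnitRL_fst : (x + t • (rbUnitRL : RBPhaseSpace N)).1 = x.1 := by
  simp [rbUnitRL]
/-- Component bookkeeping for moving along a coordinate direction (`add_smul_rbUnitRL_snd_fst`). [folklore] -/
@[simp] theorem add_smul_rbUnitRL_snd_fst :
    (x + t • (rbUnitRL : RBPhaseSpace N)).2.1 = x.2.1 + t := by simp [rbUnitRL]
/-- Component bookkeeping for moving along a coordinate direction (`add_smul_rbUnitRL_snd_snd`). [folklore] -/
@[simp] theorem add_smul_rbUnitRL_snd_snd :
    (x + t • (rbUnitRL : RBPhaseSpace N)).2.2 = x.2.2 := by simp [rbUnitRL]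
/-- Component bookkeeping for moving along a coordinate direction (`add_smul_rbUnitRR_fst`). [folklore] -/
@[simp] theorem add_smul_rbUnitRR_fst : (x + t • (rbUnitRR : RBPhaseSpace N)).1 = x.1 := by
  simp [rbUnitRR]
/-- Component bookkeeping for moving along a coordinate direction (`add_smul_rbUnitRR_snd_fst`). [folklore] -/
@[simp] theorem add_smul_rbUnitRR_snd_fst :
    (x + t • (rbUnitRR : RBPhaseSpace N)).2.1 = x.2.1 := by simp [rbUnitRR]
/-- Component bookkeeping for moving along a coordinate direction (`add_smul_rbUnitRR_snd_snd`). [folklore] -/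
@[simp] theorem add_smul_rbUnitRR_snd_snd :
    (x + t • (rbUnitRR : RBPhaseSpace N)).2.2 = x.2.2 + t := by simp [rbUnitRR]

end Moves

namespace OscillatorChain

variable (P : OscillatorChain)

/-! ### The drift of (RBT-SDE) -/

/-- The drift vector field `X₀` of the Rey-Bellet–Thomas effective equations (RBT-SDE)
`q̇ = p`, `ṗ = -∇_qV(q) - Λᵀ r`, `ṙ = -γ r + Λ p` (noise dropped), with
`Λ(x_1,…,x_n) = (λx_1, λx_n)`: the first-order part of the generator `L` of RBT eq. (13),
`L f = X₀ f + γ(T_L ∂²_{r_L} + T_R ∂²_{r_R}) f` (`rbGenerator_eq_hormanderOp`).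
[cite: ReyBelletThomas2002, §2 eq. (13)] -/
def rbDrift (Λ : ℝ) (N : ℕ) (x : RBPhaseSpace N) : RBPhaseSpace N :=
  ((x.1.2, fun i => -partialQ i (P.hamiltonian N) x.1 -
      Λ * ((if i.val = 0 then x.2.1 else 0) + (if i.val = N - 1 then x.2.2 else 0))),
    (-(P.γ * x.2.1) + Λ * ∑ i : Fin N, (if i.val = 0 then x.1.2 i else 0),
      -(P.γ * x.2.2) + Λ * ∑ i : Fin N, (if i.val = N - 1 then x.1.2 i else 0)))

variable {P} in
/-- Closed form of the drift for differentiable potentials (`∂_{q_i}H = ∂Φ/∂q_i`). [folklore] -/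
theorem rbDrift_eq (hU : Differentiable ℝ P.U) (hV : Differentiable ℝ P.V) (Λ : ℝ) (N : ℕ) :
    P.rbDrift Λ N = fun x =>
      ((x.1.2, fun i => -P.dPotential N i x.1.1 -
          Λ * ((if i.val = 0 then x.2.1 else 0) + (if i.val = N - 1 then x.2.2 else 0))),
        (-(P.γ * x.2.1) + Λ * ∑ i : Fin N, (if i.val = 0 then x.1.2 i else 0),
          -(P.γ * x.2.2) + Λ * ∑ i : Fin N, (if i.val = N - 1 then x.1.2 i else 0))) := by
  funext x
  simp only [rbDrift, P.partialQ_hamiltonian_eq_dPotential hU hV]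

/-- The drift is smooth for smooth potentials. [folklore] -/
theorem contDiff_rbDrift (hU : ContDiff ℝ ∞ P.U) (hV : ContDiff ℝ ∞ P.V) (Λ : ℝ) (N : ℕ) :
    ContDiff ℝ ∞ (P.rbDrift Λ N) := by
  rw [rbDrift_eq (hU.differentiable (by simp)) (hV.differentiable (by simp))]
  have hq : ∀ m : Fin N, ContDiff ℝ ∞ fun x : RBPhaseSpace N => x.1.1 m := fun m =>
    (contDiff_apply ℝ ℝ m).comp (contDiff_fst.comp contDiff_fst)
  have hp : ∀ m : Fin N, ContDiff ℝ ∞ fun x : RBPhaseSpace N => x.1.2 m := fun m =>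
    (contDiff_apply ℝ ℝ m).comp (contDiff_snd.comp contDiff_fst)
  have hrL : ContDiff ℝ ∞ fun x : RBPhaseSpace N => x.2.1 := contDiff_fst.comp contDiff_snd
  have hrR : ContDiff ℝ ∞ fun x : RBPhaseSpace N => x.2.2 := contDiff_snd.comp contDiff_snd
  refine ((contDiff_snd.comp contDiff_fst).prodMk (contDiff_pi.2 fun i => ?_)).prodMk
    (ContDiff.prodMk ?_ ?_)
  · refine (((P.contDiff_dPotential hU hV N i).comp (contDiff_fst.comp contDiff_fst)).neg).sub
      (contDiff_const.mul (ContDiff.add ?_ ?_))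
    · by_cases h : i.val = 0 <;> simp only [h, if_true, if_false] <;> first
        | exact hrL | exact contDiff_const
    · by_cases h : i.val = N - 1 <;> simp only [h, if_true, if_false] <;> first
        | exact hrR | exact contDiff_const
  · refine (contDiff_const.mul hrL).neg.add (contDiff_const.mul (ContDiff.sum fun i _ => ?_))
    by_cases h : i.val = 0 <;> simp only [h, if_true, if_false]
    · exact hp i
    · exact contDiff_const
  · refine (contDiff_const.mul hrR).neg.add (contDiff_const.mul (ContDiff.sum fun i _ => ?_))
    by_cases h : i.val = N - 1 <;> simp only [h, if_true, if_false]
    · exact hp i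
    · exact contDiff_const

/-! ### Derivatives of the drift along the coordinate directions -/

section Derivatives

variable (hU : ContDiff ℝ ∞ P.U) (hV : ContDiff ℝ ∞ P.V) (Λ : ℝ) (N : ℕ)
include hU hV

/-- `∂X₀/∂r_L = ((0, -Λ e_0), (-γ, 0))`. [folklore] -/
theorem hasLineDerivAt_rbDrift_rbUnitRL (x : RBPhaseSpace N) :
    HasLineDerivAt ℝ (P.rbDrift Λ N)
      (((0, fun i => if i.val = 0 then -Λ else 0), (-P.γ, 0)) : RBPhaseSpace N) x rbUnitRL := by
  unfold HasLineDerivAt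
  rw [rbDrift_eq (hU.differentiable (by simp)) (hV.differentiable (by simp))]
  simp only [add_smul_rbUnitRL_fst, add_smul_rbUnitRL_snd_fst, add_smul_rbUnitRL_snd_snd]
  have ht : HasDerivAt (fun t : ℝ => x.2.1 + t) 1 0 := by
    simpa using (hasDerivAt_id (0 : ℝ)).const_add x.2.1
  refine ((hasDerivAt_const (0 : ℝ) x.1.2).prodMk (hasDerivAt_pi.2 fun i => ?_)).prodMk
    (HasDerivAt.prodMk ?_ ?_)
  · by_cases hi : i.val = 0
    · simp only [if_pos hi]
      refine (((ht.add_const (if i.val = N - 1 then x.2.2 else 0)).const_mul Λ).const_sub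
        (-P.dPotential N i x.1.1)).congr_deriv ?_
      ring
    · simp only [if_neg hi]
      exact hasDerivAt_const _ _
  · refine (((ht.const_mul P.γ).neg).add_const
      (Λ * ∑ i : Fin N, (if i.val = 0 then x.1.2 i else 0))).congr_deriv ?_
    ring
  · exact hasDerivAt_const _ _

/-- `∂X₀/∂r_R = ((0, -Λ e_{N-1}), (0, -γ))`. [folklore] -/
theorem hasLineDerivAt_rbDrift_rbUnitRR (x : RBPhaseSpace N) :
    HasLineDerivAt ℝ (P.rbDrift Λ N)
      (((0, fun i => if i.val = N - 1 then -Λ else 0), (0, -P.γ)) : RBPhaseSpace N) x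
      rbUnitRR := by
  unfold HasLineDerivAt
  rw [rbDrift_eq (hU.differentiable (by simp)) (hV.differentiable (by simp))]
  simp only [add_smul_rbUnitRR_fst, add_smul_rbUnitRR_snd_fst, add_smul_rbUnitRR_snd_snd]
  have ht : HasDerivAt (fun t : ℝ => x.2.2 + t) 1 0 := by
    simpa using (hasDerivAt_id (0 : ℝ)).const_add x.2.2
  refine ((hasDerivAt_const (0 : ℝ) x.1.2).prodMk (hasDerivAt_pi.2 fun i => ?_)).prodMk
    (HasDerivAt.prodMk ?_ ?_)
  · by_cases hi : i.val = N - 1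
    · simp only [if_pos hi]
      refine (((ht.const_add (if i.val = 0 then x.2.1 else 0)).const_mul Λ).const_sub
        (-P.dPotential N i x.1.1)).congr_deriv ?_
      ring
    · simp only [if_neg hi]
      exact hasDerivAt_const _ _
  · exact hasDerivAt_const _ _
  · refine (((ht.const_mul P.γ).neg).add_const
      (Λ * ∑ i : Fin N, (if i.val = N - 1 then x.1.2 i else 0))).congr_deriv ?_
    ring

/-- `∂X₀/∂p_j = ((e_j, 0), (Λ[j = 0], Λ[j = N-1]))`. [folklore] -/
theorem hasLineDerivAt_rbDrift_rbUnitP (x : RBPhaseSpace N) (j : Fin N) :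
    HasLineDerivAt ℝ (P.rbDrift Λ N)
      (((Pi.single j 1, 0), (Λ * (if j.val = 0 then 1 else 0), Λ * (if j.val = N - 1 then 1 else 0))) :
        RBPhaseSpace N) x (rbUnitP j) := by
  unfold HasLineDerivAt
  rw [rbDrift_eq (hU.differentiable (by simp)) (hV.differentiable (by simp))]
  simp only [add_smul_rbUnitP_fst_fst, add_smul_rbUnitP_fst_snd, add_smul_rbUnitP_snd]
  have hlin : HasDerivAt (fun t : ℝ => x.1.2 + t • (Pi.single j (1 : ℝ) : Fin N → ℝ))
      (Pi.single j 1) 0 := by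
    simpa using ((hasDerivAt_id (0 : ℝ)).smul_const (Pi.single j (1 : ℝ) : Fin N → ℝ)).const_add
      x.1.2
  have hco : ∀ m : Fin N, HasDerivAt (fun t : ℝ => (x.1.2 + t • (Pi.single j (1 : ℝ) : Fin N → ℝ)) m)
      (if m = j then 1 else 0) 0 := fun m => by
    have := (hasDerivAt_pi.1 hlin) m
    simpa [Pi.single_apply] using this
  refine (hlin.prodMk ?_).prodMk (HasDerivAt.prodMk ?_ ?_)
  · simpa using hasDerivAt_const (0 : ℝ) (fun i : Fin N => -P.dPotential N i x.1.1 -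
      Λ * ((if i.val = 0 then x.2.1 else 0) + (if i.val = N - 1 then x.2.2 else 0)))
  · have hs : HasDerivAt (fun t : ℝ => ∑ i : Fin N,
        (if i.val = 0 then (x.1.2 + t • (Pi.single j (1 : ℝ) : Fin N → ℝ)) i else 0))
        (∑ i : Fin N, (if i.val = 0 then (if i = j then (1 : ℝ) else 0) else 0)) 0 := by
      refine HasDerivAt.fun_sum fun i _ => ?_
      by_cases hi : i.val = 0
      · simp only [hi, if_true]; exact hco i
      · simp only [hi, if_false]; exact hasDerivAt_const _ _
    have h := (hs.const_mul Λ).const_add (-(P.γ * x.2.1))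
    convert h using 2
    rw [Finset.sum_eq_single_of_mem j (mem_univ _) (fun b _ hb => by simp [hb])]
    simp
  · have hs : HasDerivAt (fun t : ℝ => ∑ i : Fin N,
        (if i.val = N - 1 then (x.1.2 + t • (Pi.single j (1 : ℝ) : Fin N → ℝ)) i else 0))
        (∑ i : Fin N, (if i.val = N - 1 then (if i = j then (1 : ℝ) else 0) else 0)) 0 := by
      refine HasDerivAt.fun_sum fun i _ => ?_
      by_cases hi : i.val = N - 1
      · simp only [hi, if_true]; exact hco i
      · simp only [hi, if_false]; exact hasDerivAt_const _ _
    have h := (hs.const_mul Λ).const_add (-(P.γ * x.2.2))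
    convert h using 2
    rw [Finset.sum_eq_single_of_mem j (mem_univ _) (fun b _ hb => by simp [hb])]
    simp

/-- `∂X₀/∂q_j = ((0, -(∂²Φ/∂q_j∂q_i)_i), (0, 0))`. [folklore] -/
theorem hasLineDerivAt_rbDrift_rbUnitQ (x : RBPhaseSpace N) (j : Fin N) :
    HasLineDerivAt ℝ (P.rbDrift Λ N)
      (((0, fun i => -P.hessPotential N i j x.1.1), (0, 0)) : RBPhaseSpace N) x (rbUnitQ j) := by
  unfold HasLineDerivAt
  rw [rbDrift_eq (hU.differentiable (by simp)) (hV.differentiable (by simp))]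
  simp only [add_smul_rbUnitQ_fst_fst, add_smul_rbUnitQ_fst_snd, add_smul_rbUnitQ_snd]
  have hU' : ContDiff ℝ ∞ (deriv P.U) := hU.deriv'
  have hV' : ContDiff ℝ ∞ (deriv P.V) := hV.deriv'
  have hU2 : Differentiable ℝ (deriv P.U) := hU'.differentiable (by simp)
  have hV2 : Differentiable ℝ (deriv P.V) := hV'.differentiable (by simp)
  refine ((hasDerivAt_const (0 : ℝ) x.1.2).prodMk (hasDerivAt_pi.2 fun i => ?_)).prodMk ?_
  · have h := (P.hasDerivAt_dPotential_add_smul hU2 hV2 N x.1.1 i j).neg.sub_const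
      (Λ * ((if i.val = 0 then x.2.1 else 0) + (if i.val = N - 1 then x.2.2 else 0)))
    simpa using h
  · exact (hasDerivAt_const (0 : ℝ)
      ((-(P.γ * x.2.1) + Λ * ∑ i : Fin N, (if i.val = 0 then x.1.2 i else 0),
        -(P.γ * x.2.2) + Λ * ∑ i : Fin N, (if i.val = N - 1 then x.1.2 i else 0)) : ℝ × ℝ)).congr_deriv
      rfl

omit hU hV in
variable {P Λ N} in
/-- From a line derivative of the (differentiable) drift to its Fréchet derivative. [folklore] -/
theorem fderiv_rbDrift_of_hasLineDerivAt (hd : Differentiable ℝ (P.rbDrift Λ N))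
    {x v w : RBPhaseSpace N} (h : HasLineDerivAt ℝ (P.rbDrift Λ N) w x v) :
    fderiv ℝ (P.rbDrift Λ N) x v = w := by
  rw [← (hd x).lineDeriv_eq_fderiv]
  exact h.lineDeriv

/-- `DX₀(x)·∂_{r_L}`. [folklore] -/
theorem fderiv_rbDrift_rbUnitRL (x : RBPhaseSpace N) :
    fderiv ℝ (P.rbDrift Λ N) x rbUnitRL =
      (((0, fun i => if i.val = 0 then -Λ else 0), (-P.γ, 0)) : RBPhaseSpace N) :=
  fderiv_rbDrift_of_hasLineDerivAt ((P.contDiff_rbDrift hU hV Λ N).differentiable (by simp))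
    (P.hasLineDerivAt_rbDrift_rbUnitRL hU hV Λ N x)

/-- `DX₀(x)·∂_{r_R}`. [folklore] -/
theorem fderiv_rbDrift_rbUnitRR (x : RBPhaseSpace N) :
    fderiv ℝ (P.rbDrift Λ N) x rbUnitRR =
      (((0, fun i => if i.val = N - 1 then -Λ else 0), (0, -P.γ)) : RBPhaseSpace N) :=
  fderiv_rbDrift_of_hasLineDerivAt ((P.contDiff_rbDrift hU hV Λ N).differentiable (by simp))
    (P.hasLineDerivAt_rbDrift_rbUnitRR hU hV Λ N x)

/-- `DX₀(x)·∂_{p_j}`. [folklore] -/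
theorem fderiv_rbDrift_rbUnitP (x : RBPhaseSpace N) (j : Fin N) :
    fderiv ℝ (P.rbDrift Λ N) x (rbUnitP j) =
      (((Pi.single j 1, 0), (Λ * (if j.val = 0 then 1 else 0), Λ * (if j.val = N - 1 then 1 else 0))) :
        RBPhaseSpace N) :=
  fderiv_rbDrift_of_hasLineDerivAt ((P.contDiff_rbDrift hU hV Λ N).differentiable (by simp))
    (P.hasLineDerivAt_rbDrift_rbUnitP hU hV Λ N x j)

/-- `DX₀(x)·∂_{q_j}`. [folklore] -/
theorem fderiv_rbDrift_rbUnitQ (x : RBPhaseSpace N) (j : Fin N) :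
    fderiv ℝ (P.rbDrift Λ N) x (rbUnitQ j) =
      (((0, fun i => -P.hessPotential N i j x.1.1), (0, 0)) : RBPhaseSpace N) :=
  fderiv_rbDrift_of_hasLineDerivAt ((P.contDiff_rbDrift hU hV Λ N).differentiable (by simp))
    (P.hasLineDerivAt_rbDrift_rbUnitQ hU hV Λ N x j)

end Derivatives

/-! ### The Hörmander family of the generator -/

/-- The reservoir directions `∂_{r_L}, ∂_{r_R}`, indexed by `Fin 2`. [folklore] -/
def rbBathVec (N : ℕ) : Fin 2 → RBPhaseSpace N := ![rbUnitRL, rbUnitRR]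

/-- The constant noise vector fields `X_b = √(γ T_b) ∂_{r_b}` of the two reservoirs
(`dr_b = … + (2γT_b)^{1/2} dω_b`, so that the second-order part of `L` is
`γ(T_L ∂²_{r_L} + T_R ∂²_{r_R}) = ∑_b X_b²`). [cite: ReyBelletThomas2002, §2 eq. (13)] -/
def rbBathField (T_L T_R : ℝ) (b : Fin 2) (_x : RBPhaseSpace N) : RBPhaseSpace N :=
  Real.sqrt (P.γ * bathTemp T_L T_R b) • rbBathVec N b

/-- The family `(X₀, X_L, X_R)` of the generator `L = X_L² + X_R² + X₀` of (RBT-SDE) in Hörmander's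
form, indexed by `Option (Fin 2)` as in `Literature.Analysis.Distribution.Hormander1967_thm11`
(`none ↦ X₀ = rbDrift`, `some b ↦ X_b = rbBathField b`). [cite: ReyBelletThomas2002, §4 eq. (45)] -/
def rbHormanderFamily (Λ : ℝ) (N : ℕ) (T_L T_R : ℝ) :
    Option (Fin 2) → RBPhaseSpace N → RBPhaseSpace N :=
  fun o => o.elim (P.rbDrift Λ N) (P.rbBathField T_L T_R)

/-- All fields of the family are smooth (smooth potentials). [folklore] -/
theorem contDiff_rbHormanderFamily (hU : ContDiff ℝ ∞ P.U) (hV : ContDiff ℝ ∞ P.V) (Λ : ℝ)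
    (N : ℕ) (T_L T_R : ℝ) (o : Option (Fin 2)) :
    ContDiff ℝ ∞ (P.rbHormanderFamily Λ N T_L T_R o) := by
  cases o with
  | none => exact P.contDiff_rbDrift hU hV Λ N
  | some b => exact contDiff_const

/-- For differentiable `f`, `X₀ f = Df·X₀` in coordinates, grouped by site:
`∑_i [p_i ∂_{q_i}f + (-∂_{q_i}H - Λ([i=0]r_L + [i=N-1]r_R)) ∂_{p_i}f + Λ[i=0]p_i ∂_{r_L}f + Λ[i=N-1]p_i ∂_{r_R}f]`
`- γ r_L ∂_{r_L}f - γ r_R ∂_{r_R}f`. [folklore] -/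
theorem fderiv_apply_rbDrift (f : RBPhaseSpace N → ℝ) (Λ : ℝ) (x : RBPhaseSpace N) :
    fderiv ℝ f x (P.rbDrift Λ N x) =
      (∑ i, (x.1.2 i * fderiv ℝ f x (rbUnitQ i) +
        (-partialQ i (P.hamiltonian N) x.1 -
            Λ * ((if i.val = 0 then x.2.1 else 0) + (if i.val = N - 1 then x.2.2 else 0))) *
          fderiv ℝ f x (rbUnitP i) +
        Λ * (if i.val = 0 then x.1.2 i else 0) * fderiv ℝ f x rbUnitRL +
        Λ * (if i.val = N - 1 then x.1.2 i else 0) * fderiv ℝ f x rbUnitRR)) +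
      (-(P.γ * x.2.1) * fderiv ℝ f x rbUnitRL + -(P.γ * x.2.2) * fderiv ℝ f x rbUnitRR) := by
  rw [clm_apply_eq_sum_rbUnit]
  have h1 : (P.rbDrift Λ N x).1.1 = x.1.2 := rfl
  have h2 : (P.rbDrift Λ N x).1.2 = fun i => -partialQ i (P.hamiltonian N) x.1 -
      Λ * ((if i.val = 0 then x.2.1 else 0) + (if i.val = N - 1 then x.2.2 else 0)) := rfl
  have h3 : (P.rbDrift Λ N x).2.1 =
      -(P.γ * x.2.1) + Λ * ∑ i : Fin N, (if i.val = 0 then x.1.2 i else 0) := rfl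
  have h4 : (P.rbDrift Λ N x).2.2 =
      -(P.γ * x.2.2) + Λ * ∑ i : Fin N, (if i.val = N - 1 then x.1.2 i else 0) := rfl
  simp only [h1, h2, h3, h4, smul_eq_mul]
  rw [add_mul (-(P.γ * x.2.1)), add_mul (-(P.γ * x.2.2)), Finset.mul_sum, Finset.mul_sum,
    Finset.sum_mul, Finset.sum_mul, ← Finset.sum_add_distrib]
  rw [show ∀ A c D e G : ℝ, A + (c + D) + (e + G) = A + D + G + (c + e) from
    fun _ _ _ _ _ => by ring]
  rw [← Finset.sum_add_distrib, ← Finset.sum_add_distrib]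

/-- `X_b (X_b f) = γ T_b ∂²_{r_b} f` for the constant field `X_b = √(γT_b) ∂_{r_b}`, `γ T_b ≥ 0`,
`f ∈ C^∞`. [folklore] -/
theorem fieldDeriv_fieldDeriv_const_smul (s : ℝ) (u : RBPhaseSpace N) {f : RBPhaseSpace N → ℝ}
    (hf : ContDiff ℝ ∞ f) (x : RBPhaseSpace N) :
    fieldDeriv (fun _ => s • u) (fieldDeriv (fun _ => s • u) f) x =
      s * s * lineDeriv ℝ (fun y => lineDeriv ℝ f y u) x u := by
  have hfd : Differentiable ℝ f := hf.differentiable (by simp)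
  have h1 : fieldDeriv (fun _ => s • u) f = fun y => s * fderiv ℝ f y u := by
    funext y
    simp [fieldDeriv, map_smul]
  have hg : ContDiff ℝ ∞ fun y => fderiv ℝ f y u :=
    (hf.fderiv_right (m := ∞) (by exact_mod_cast le_top)).clm_apply contDiff_const
  have hgd : Differentiable ℝ fun y => fderiv ℝ f y u := hg.differentiable (by simp)
  have h2 : (fun y => lineDeriv ℝ f y u) = fun y => fderiv ℝ f y u :=
    funext fun y => (hfd y).lineDeriv_eq_fderiv
  rw [fieldDeriv, h1, h2, (hgd x).lineDeriv_eq_fderiv, map_smul, fderiv_const_mul (hgd x),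
    show (s • fderiv ℝ (fun y => fderiv ℝ f y u) x) u = s • fderiv ℝ (fun y => fderiv ℝ f y u) x u
      from rfl]
  simp only [smul_eq_mul]
  ring

/-- **The generator `L` of RBT eq. (13) in Hörmander's form**: for `γT_L, γT_R ≥ 0` and smooth
`f`, `L f = ∑_b X_b (X_b f) + X₀ f` with `X_b = √(γT_b) ∂_{r_b}` and `X₀ = rbDrift`
(`hormanderOp X₀ X 0`), so `rbHormanderFamily` is the family of "the generator `L` given by
Eq. (13)" of Proposition 4.1. [cite: ReyBelletThomas2002, §2 eq. (13)] -/
theorem rbGenerator_eq_hormanderOp (Λ : ℝ) {T_L T_R : ℝ} (hL : 0 ≤ P.γ * T_L)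
    (hR : 0 ≤ P.γ * T_R) {f : RBPhaseSpace N → ℝ} (hf : ContDiff ℝ ∞ f) (x : RBPhaseSpace N) :
    P.rbGenerator Λ N T_L T_R f x =
      hormanderOp (P.rbDrift Λ N) (P.rbBathField (N := N) T_L T_R) (fun _ => 0) f x := by
  have hfd : Differentiable ℝ f := hf.differentiable (by simp)
  -- coordinate derivatives as Fréchet derivatives
  have hQ : ∀ i, rbPartialQ i f x = fderiv ℝ f x (rbUnitQ i) := fun i => by
    simp only [rbPartialQ_eq_lineDeriv, rbUnitQ_eq]
    exact (hfd x).lineDeriv_eq_fderiv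
  have hP : ∀ i, rbPartialP i f x = fderiv ℝ f x (rbUnitP i) := fun i => by
    simp only [rbPartialP_eq_lineDeriv, rbUnitP_eq]
    exact (hfd x).lineDeriv_eq_fderiv
  have hL' : partialRL f x = fderiv ℝ f x rbUnitRL := by
    simp only [partialRL_eq_lineDeriv, rbUnitRL_eq]
    exact (hfd x).lineDeriv_eq_fderiv
  have hR' : partialRR f x = fderiv ℝ f x rbUnitRR := by
    simp only [partialRR_eq_lineDeriv, rbUnitRR_eq]
    exact (hfd x).lineDeriv_eq_fderiv
  -- second-order terms
  have hb : ∀ b : Fin 2, fieldDeriv (P.rbBathField (N := N) T_L T_R b)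
      (fieldDeriv (P.rbBathField (N := N) T_L T_R b) f) x =
      P.γ * bathTemp T_L T_R b *
        lineDeriv ℝ (fun y => lineDeriv ℝ f y (rbBathVec N b)) x (rbBathVec N b) := by
    intro b
    unfold rbBathField
    rw [fieldDeriv_fieldDeriv_const_smul _ _ hf, Real.mul_self_sqrt]
    fin_cases b
    · exact hL
    · exact hR
  have hLL : partialRL (partialRL f) x =
      lineDeriv ℝ (fun y => lineDeriv ℝ f y (rbBathVec N 0)) x (rbBathVec N 0) := by
    simp only [partialRL_eq_lineDeriv, rbBathVec, Matrix.cons_val_zero, rbUnitRL_eq]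
  have hRR : partialRR (partialRR f) x =
      lineDeriv ℝ (fun y => lineDeriv ℝ f y (rbBathVec N 1)) x (rbBathVec N 1) := by
    simp only [partialRR_eq_lineDeriv, rbBathVec, Matrix.cons_val_one, Matrix.cons_val_zero,
      rbUnitRR_eq]
  rw [hormanderOp, Fin.sum_univ_two, hb, hb, fieldDeriv_apply, P.fderiv_apply_rbDrift, ← hLL,
    ← hRR, rbGenerator]
  simp only [bathTemp, Matrix.cons_val_zero, Matrix.cons_val_one, zero_mul, add_zero, hQ, hP,
    hL', hR']
  -- per-site bookkeeping
  have key : ∀ i : Fin N,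
      x.1.2 i * fderiv ℝ f x (rbUnitQ i) -
          partialQ i (P.hamiltonian N) x.1 * fderiv ℝ f x (rbUnitP i) +
        Λ * ((if i.val = 0 then x.1.2 i * fderiv ℝ f x rbUnitRL - x.2.1 * fderiv ℝ f x (rbUnitP i)
              else 0) +
            (if i.val = N - 1 then
              x.1.2 i * fderiv ℝ f x rbUnitRR - x.2.2 * fderiv ℝ f x (rbUnitP i) else 0)) =
      x.1.2 i * fderiv ℝ f x (rbUnitQ i) +
        (-partialQ i (P.hamiltonian N) x.1 -
            Λ * ((if i.val = 0 then x.2.1 else 0) + (if i.val = N - 1 then x.2.2 else 0))) *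
          fderiv ℝ f x (rbUnitP i) +
        Λ * (if i.val = 0 then x.1.2 i else 0) * fderiv ℝ f x rbUnitRL +
        Λ * (if i.val = N - 1 then x.1.2 i else 0) * fderiv ℝ f x rbUnitRR := fun i => by
    split_ifs <;> ring
  rw [← Finset.sum_congr rfl fun i _ => key i]
  simp only [Finset.sum_add_distrib, Finset.sum_sub_distrib, Finset.mul_sum, mul_add]
  ring

/-! ### RBT Proposition 4.1: the bracket condition -/

section Brackets

variable {P} {Λ : ℝ} {T_L T_R : ℝ} (hU : ContDiff ℝ ∞ P.U) (hV : ContDiff ℝ ∞ P.V)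
include hU hV

/-- Abbreviation-free form of "all fields of the family are smooth". [folklore] -/
theorem rbHormanderFamily_smooth (Λ : ℝ) (N : ℕ) (T_L T_R : ℝ) :
    ∀ o, ContDiff ℝ ∞ (P.rbHormanderFamily Λ N T_L T_R o) :=
  P.contDiff_rbHormanderFamily hU hV Λ N T_L T_R

omit hU hV in
/-- `∂_{r_L}` is in the germ module (indeed in `lieSpan`): `X_L = √(γT_L) ∂_{r_L}`, `γT_L > 0`.
[cite: ReyBelletThomas2002, Prop 4.1] -/
theorem inGermModule_rbUnitRL (hL : 0 < P.γ * T_L) (x₀ : RBPhaseSpace N) :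
    InGermModule (P.rbHormanderFamily Λ N T_L T_R) x₀ (fun _ => rbUnitRL) := by
  have hs : Real.sqrt (P.γ * T_L) ≠ 0 := Real.sqrt_ne_zero'.2 hL
  have h : InGermModule (P.rbHormanderFamily Λ N T_L T_R) x₀
      ((Real.sqrt (P.γ * T_L))⁻¹ • P.rbHormanderFamily Λ N T_L T_R (some 0)) :=
    (InGermModule.mem (mem_lieSpan_of (some 0))).const_smul _
  have e : ((Real.sqrt (P.γ * T_L))⁻¹ • P.rbHormanderFamily Λ N T_L T_R (some 0)) =
      fun _ => (rbUnitRL : RBPhaseSpace N) := by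
    funext y
    simp [rbHormanderFamily, rbBathField, rbBathVec, bathTemp, smul_smul, inv_mul_cancel₀ hs]
  rwa [e] at h

omit hU hV in
/-- `∂_{r_R}` is in the germ module: `X_R = √(γT_R) ∂_{r_R}`, `γT_R > 0`.
[cite: ReyBelletThomas2002, Prop 4.1] -/
theorem inGermModule_rbUnitRR (hR : 0 < P.γ * T_R) (x₀ : RBPhaseSpace N) :
    InGermModule (P.rbHormanderFamily Λ N T_L T_R) x₀ (fun _ => rbUnitRR) := by
  have hs : Real.sqrt (P.γ * T_R) ≠ 0 := Real.sqrt_ne_zero'.2 hR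
  have h : InGermModule (P.rbHormanderFamily Λ N T_L T_R) x₀
      ((Real.sqrt (P.γ * T_R))⁻¹ • P.rbHormanderFamily Λ N T_L T_R (some 1)) :=
    (InGermModule.mem (mem_lieSpan_of (some 1))).const_smul _
  have e : ((Real.sqrt (P.γ * T_R))⁻¹ • P.rbHormanderFamily Λ N T_L T_R (some 1)) =
      fun _ => (rbUnitRR : RBPhaseSpace N) := by
    funext y
    simp [rbHormanderFamily, rbBathField, rbBathVec, bathTemp, smul_smul, inv_mul_cancel₀ hs]
  rwa [e] at h

/-- The bracket of a constant field `v` in the germ module with `X₀` puts `y ↦ DX₀(y)·v` in the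
germ module. [folklore] -/
theorem inGermModule_fderiv_rbDrift {x₀ v : RBPhaseSpace N}
    (hv : InGermModule (P.rbHormanderFamily Λ N T_L T_R) x₀ (fun _ => v)) :
    InGermModule (P.rbHormanderFamily Λ N T_L T_R) x₀ fun y => fderiv ℝ (P.rbDrift Λ N) y v := by
  have h := hv.lieBracket (P.rbHormanderFamily_smooth hU hV Λ N T_L T_R)
    (InGermModule.mem (mem_lieSpan_of none))
  rwa [show P.rbHormanderFamily Λ N T_L T_R none = P.rbDrift Λ N from rfl,
    lieBracket_const_left] at h

omit hU hV in
/-- `((e_i, 0), (a, b)) = ∂_{q_i} + a ∂_{r_L} + b ∂_{r_R}`. [folklore] -/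
theorem mk_single_eq_rbUnitQ_add (i : Fin N) (a b : ℝ) :
    ((((Pi.single i (1 : ℝ), (0 : Fin N → ℝ)), (a, b)) : RBPhaseSpace N)) =
      rbUnitQ i + a • rbUnitRL + b • rbUnitRR := by
  refine Prod.ext (Prod.ext ?_ ?_) (Prod.ext ?_ ?_) <;> simp [rbUnitQ, rbUnitRL, rbUnitRR]

/-- **Momentum ⇒ position**: if `∂_{p_i}` is in the germ module then so is `∂_{q_i}`
(`[∂_{p_i}, X₀] = ∂_{q_i} + Λ([i = 0] ∂_{r_L} + [i = N-1] ∂_{r_R})`; RBT: "yield the vector fields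
`∂_{p₁}` and `∂_{q₁}`"). [cite: ReyBelletThomas2002, Prop 4.1] -/
theorem inGermModule_rbUnitQ_of_rbUnitP (hL : 0 < P.γ * T_L) (hR : 0 < P.γ * T_R)
    {x₀ : RBPhaseSpace N} {i : Fin N}
    (hi : InGermModule (P.rbHormanderFamily Λ N T_L T_R) x₀ (fun _ => rbUnitP i)) :
    InGermModule (P.rbHormanderFamily Λ N T_L T_R) x₀ (fun _ => rbUnitQ i) := by
  have h := P.inGermModule_fderiv_rbDrift hU hV hi
  simp only [P.fderiv_rbDrift_rbUnitP hU hV, mk_single_eq_rbUnitQ_add] at h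
  have h' := h.sub ((((P.inGermModule_rbUnitRL hL x₀).const_smul
    (Λ * (if i.val = 0 then 1 else 0))).add
    ((P.inGermModule_rbUnitRR hR x₀).const_smul (Λ * (if i.val = N - 1 then 1 else 0)))))
  have e : ((fun _ : RBPhaseSpace N => (rbUnitQ i : RBPhaseSpace N) +
      (Λ * (if i.val = 0 then 1 else 0)) • rbUnitRL + (Λ * (if i.val = N - 1 then 1 else 0)) • rbUnitRR) -
      ((Λ * (if i.val = 0 then 1 else 0)) • (fun _ : RBPhaseSpace N => (rbUnitRL : RBPhaseSpace N)) +
        (Λ * (if i.val = N - 1 then 1 else 0)) • (fun _ : RBPhaseSpace N => (rbUnitRR : RBPhaseSpace N)))) =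
      fun _ => rbUnitQ i := by
    funext y
    simp only [Pi.sub_apply, Pi.add_apply, Pi.smul_apply]
    abel
  rwa [e] at h'

omit hU hV in
/-- `((0, -Λ e_0), (-γ, 0)) = -Λ ∂_{p_i} - γ ∂_{r_L}` for the site `i` with `i.val = 0`. [folklore] -/
theorem mk_col_zero_eq (i : Fin N) (hi : i.val = 0) (a c : ℝ) :
    ((((0 : Fin N → ℝ), fun j : Fin N => if j.val = 0 then a else 0), (c, (0 : ℝ))) :
      RBPhaseSpace N) = a • rbUnitP i + c • rbUnitRL := by
  have hij : ∀ j : Fin N, j.val = 0 ↔ j = i := fun j =>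
    ⟨fun h => Fin.ext (by omega), fun h => by rw [h]; exact hi⟩
  refine Prod.ext (Prod.ext ?_ (funext fun j => ?_)) (Prod.ext ?_ ?_)
  · simp [rbUnitP, rbUnitRL]
  · by_cases hj : j = i
    · subst hj
      simp [rbUnitP, rbUnitRL, hi]
    · have hj0 : ¬ (j.val = 0) := fun h => hj ((hij j).1 h)
      simp [rbUnitP, rbUnitRL, hj0, hj]
  · simp [rbUnitP, rbUnitRL]
  · simp [rbUnitP, rbUnitRL]

/-- **The left reservoir yields `∂_{p_0}`**: `[∂_{r_L}, X₀] = -Λ ∂_{p_0} - γ ∂_{r_L}`, `Λ ≠ 0`.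
[cite: ReyBelletThomas2002, Prop 4.1] -/
theorem inGermModule_rbUnitP_zero (hΛ : Λ ≠ 0) (hL : 0 < P.γ * T_L) (x₀ : RBPhaseSpace N)
    (i : Fin N) (hi : i.val = 0) :
    InGermModule (P.rbHormanderFamily Λ N T_L T_R) x₀ (fun _ => rbUnitP i) := by
  have h := P.inGermModule_fderiv_rbDrift (Λ := Λ) (T_L := T_L) (T_R := T_R) hU hV
    (P.inGermModule_rbUnitRL hL x₀)
  simp only [P.fderiv_rbDrift_rbUnitRL hU hV, mk_col_zero_eq i hi] at h
  have h' := (h.sub ((P.inGermModule_rbUnitRL hL x₀).const_smul (-P.γ))).const_smul (-Λ)⁻¹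
  have e : (-Λ)⁻¹ • ((fun _ : RBPhaseSpace N => (-Λ) • (rbUnitP i : RBPhaseSpace N) +
      (-P.γ) • rbUnitRL) - (-P.γ) • (fun _ : RBPhaseSpace N => (rbUnitRL : RBPhaseSpace N))) =
      fun _ => rbUnitP i := by
    funext y
    simp only [Pi.smul_apply, Pi.sub_apply, add_sub_cancel_right, smul_smul,
      inv_mul_cancel₀ (neg_ne_zero.2 hΛ), one_smul]
  rwa [e] at h'

omit hU hV in
/-- The field `y ↦ c(y) ∂_{p_i}` written out. [folklore] -/
theorem smul_rbUnitP_eq (c : RBPhaseSpace N → ℝ) (i : Fin N) :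
    (fun y => c y • (rbUnitP i : RBPhaseSpace N)) =
      fun y => ((((0 : Fin N → ℝ), Pi.single i (c y)), ((0 : ℝ), (0 : ℝ))) : RBPhaseSpace N) := by
  funext y
  refine Prod.ext (Prod.ext ?_ (funext fun j => ?_)) (Prod.ext ?_ ?_) <;>
    simp [rbUnitP, Pi.single_apply]

/-- **The column `DX₀·∂_{q_{i'}}` modulo known directions**: if `∂_{q_{i'}}` and all `∂_{p_l}`,
`l ≤ i'`, are in the germ module and `i = i' + 1`, then so is `y ↦ V''(q_i - q_{i'}) ∂_{p_i}`
(`[∂_{q_{i'}}, X₀] = -∑_l ∂²Φ/∂q_{i'}∂q_l ∂_{p_l}` is tridiagonal with the entry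
`-∂²Φ/∂q_{i'}∂q_i = V''(q_i - q_{i'})`). [cite: ReyBelletThomas2002, Prop 4.1] -/
theorem inGermModule_hess_smul_rbUnitP {x₀ : RBPhaseSpace N} {i i' : Fin N}
    (hii' : i.val = i'.val + 1)
    (hQ : InGermModule (P.rbHormanderFamily Λ N T_L T_R) x₀ (fun _ => rbUnitQ i'))
    (hPl : ∀ l : Fin N, l.val ≤ i'.val →
      InGermModule (P.rbHormanderFamily Λ N T_L T_R) x₀ (fun _ => rbUnitP l)) :
    InGermModule (P.rbHormanderFamily Λ N T_L T_R) x₀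
      (fun y => deriv (deriv P.V) (y.1.1 i - y.1.1 i') • (rbUnitP i : RBPhaseSpace N)) := by
  have h := P.inGermModule_fderiv_rbDrift hU hV hQ
  simp only [P.fderiv_rbDrift_rbUnitQ hU hV] at h
  -- the column as a sum over `l`
  have hcol : (fun y : RBPhaseSpace N =>
      ((((0 : Fin N → ℝ), fun l : Fin N => -P.hessPotential N l i' y.1.1), ((0 : ℝ), (0 : ℝ))) :
        RBPhaseSpace N)) =
      ∑ l : Fin N, fun y => (-P.hessPotential N l i' y.1.1) • (rbUnitP l : RBPhaseSpace N) := by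
    funext y
    rw [Finset.sum_apply]
    refine Prod.ext (Prod.ext ?_ (funext fun j => ?_)) (Prod.ext ?_ ?_) <;>
      simp [rbUnitP, Prod.fst_sum, Prod.snd_sum, Finset.sum_apply, Pi.single_apply]
  rw [hcol] at h
  -- split off the term `l = i`; the others are in the module or vanish
  rw [← Finset.add_sum_erase _ _ (Finset.mem_univ i)] at h
  have hrest : InGermModule (P.rbHormanderFamily Λ N T_L T_R) x₀
      (∑ l ∈ Finset.univ.erase i,
        fun y => (-P.hessPotential N l i' y.1.1) • (rbUnitP l : RBPhaseSpace N)) := by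
    refine InGermModule.finset_sum _ fun l hl => ?_
    have hli : l ≠ i := Finset.ne_of_mem_erase hl
    rcases Nat.lt_or_ge l.val i.val with hlt | hge
    · -- `l ≤ i'`: known direction, smooth coefficient
      have hsm : ContDiff ℝ ∞ fun y : RBPhaseSpace N => -P.hessPotential N l i' y.1.1 := by
        have hc : ContDiff ℝ ∞ fun y : RBPhaseSpace N => fderiv ℝ (P.rbDrift Λ N) y (rbUnitQ i') :=
          ((P.contDiff_rbDrift hU hV Λ N).fderiv_right (m := ∞) (by exact_mod_cast le_top)).clm_apply
            contDiff_const
        have : (fun y : RBPhaseSpace N => -P.hessPotential N l i' y.1.1) =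
            fun y => ((fderiv ℝ (P.rbDrift Λ N) y (rbUnitQ i')).1.2) l := by
          funext y
          rw [P.fderiv_rbDrift_rbUnitQ hU hV]
        rw [this]
        exact (contDiff_apply ℝ ℝ l).comp ((contDiff_snd.comp contDiff_fst).comp hc)
      exact (hPl l (by omega)).smul (Eventually.of_forall fun y => hsm.contDiffAt)
    · -- `l ≥ i + 1 = i' + 2`: the Hessian entry vanishes identically
      have hl2 : i'.val + 2 ≤ l.val := by
        have : l.val ≠ i.val := fun e => hli (Fin.ext e)
        omega
      have : (fun y : RBPhaseSpace N =>
          (-P.hessPotential N l i' y.1.1) • (rbUnitP l : RBPhaseSpace N)) = 0 := by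
        funext y
        rw [P.hessPotential_eq_zero_of_le N hl2, neg_zero, zero_smul]
        rfl
      rw [this]
      exact InGermModule.zero
  have hmain := h.sub hrest
  rw [add_sub_cancel_right] at hmain
  have e : (fun y : RBPhaseSpace N =>
      (-P.hessPotential N i i' y.1.1) • (rbUnitP i : RBPhaseSpace N)) =
      fun y => deriv (deriv P.V) (y.1.1 i - y.1.1 i') • (rbUnitP i : RBPhaseSpace N) := by
    funext y
    rw [P.hessPotential_succ N hii', neg_neg]
  rwa [e] at hmain

/-- The coefficient `y ↦ (-1)^k V⁽ᵏ⁾(q_i - q_{i'})`. [folklore] -/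
def bondCoeff (k : ℕ) (i i' : Fin N) (y : RBPhaseSpace N) : ℝ :=
  (-1) ^ k * iteratedDeriv k P.V (y.1.1 i - y.1.1 i')

omit hU in
/-- The bond coefficients are smooth. [folklore] -/
theorem contDiff_bondCoeff (k : ℕ) (i i' : Fin N) : ContDiff ℝ ∞ (P.bondCoeff k i i') := by
  unfold bondCoeff
  have hk : ContDiff ℝ ∞ (iteratedDeriv k P.V) := by
    rw [iteratedDeriv_eq_iterate]; exact hV.iterate_deriv k
  have hq : ∀ m : Fin N, ContDiff ℝ ∞ fun y : RBPhaseSpace N => y.1.1 m := fun m =>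
    (contDiff_apply ℝ ℝ m).comp (contDiff_fst.comp contDiff_fst)
  exact contDiff_const.mul (hk.comp ((hq i).sub (hq i')))

omit hU in
/-- Differentiating the bond coefficient along `∂_{q_{i'}}` raises its order:
`∂_{q_{i'}} [(-1)^k V⁽ᵏ⁾(q_i - q_{i'})] = (-1)^{k+1} V⁽ᵏ⁺¹⁾(q_i - q_{i'})` (`i ≠ i'`). [folklore] -/
theorem hasLineDerivAt_bondCoeff (k : ℕ) {i i' : Fin N} (hii' : i ≠ i') (y : RBPhaseSpace N) :
    HasLineDerivAt ℝ (P.bondCoeff k i i') (P.bondCoeff (k + 1) i i' y) y (rbUnitQ i') := by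
  unfold HasLineDerivAt bondCoeff
  have hk : Differentiable ℝ (iteratedDeriv k P.V) := by
    rw [iteratedDeriv_eq_iterate]; exact (hV.iterate_deriv k).differentiable (by simp)
  have hlin : HasDerivAt (fun t : ℝ => (y + t • rbUnitQ i').1.1 i - (y + t • rbUnitQ i').1.1 i')
      (-1) 0 := by
    simp only [add_smul_rbUnitQ_fst_fst, Pi.add_apply, Pi.smul_apply, Pi.single_apply,
      if_neg hii', smul_eq_mul, mul_zero, add_zero]
    have h := ((hasDerivAt_id (0 : ℝ)).const_add (y.1.1 i')).const_sub (y.1.1 i)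
    simpa using h
  have hcomp := ((hk _).hasDerivAt.comp (0 : ℝ) hlin).const_mul ((-1 : ℝ) ^ k)
  have h0 : (y + (0 : ℝ) • rbUnitQ i').1.1 i - (y + (0 : ℝ) • rbUnitQ i').1.1 i' =
      y.1.1 i - y.1.1 i' := by simp
  rw [h0, ← iteratedDeriv_succ] at hcomp
  refine hcomp.congr_deriv ?_
  rw [pow_succ]
  ring

omit hU in
/-- **The higher commutators** `Z_{k+1} = [∂_{q_{i'}}, Z_k]` for `Z_k = (-1)^k V⁽ᵏ⁾(q_i - q_{i'}) ∂_{p_i}`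
(RBT: "`[∂_{q₁}, [ ⋯, [∂_{q₁}, ∂²U⁽²⁾ ∂_{p₂}]]] = ∂^{m+1}U⁽²⁾ ∂_{p₂}`"). [cite: ReyBelletThomas2002, Prop 4.1] -/
theorem lieBracket_rbUnitQ_bondCoeff_smul (k : ℕ) {i i' : Fin N} (hii' : i ≠ i') :
    VectorField.lieBracket ℝ (fun _ => (rbUnitQ i' : RBPhaseSpace N))
      (fun y => P.bondCoeff k i i' y • (rbUnitP i : RBPhaseSpace N)) =
      fun y => P.bondCoeff (k + 1) i i' y • (rbUnitP i : RBPhaseSpace N) := by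
  funext y
  have hd : DifferentiableAt ℝ (P.bondCoeff k i i') y :=
    ((P.contDiff_bondCoeff hV k i i').differentiable (by simp)) y
  rw [lieBracket_const_smul_const _ _ hd, ← hd.lineDeriv_eq_fderiv,
    (P.hasLineDerivAt_bondCoeff hV k hii' y).lineDeriv]

/-- All `Z_k`, `k ≥ 2`, are in the germ module once `Z_2` is and `∂_{q_{i'}}` is.
[cite: ReyBelletThomas2002, Prop 4.1] -/
theorem inGermModule_bondCoeff_smul {x₀ : RBPhaseSpace N} {i i' : Fin N} (hii' : i ≠ i')
    (hQ : InGermModule (P.rbHormanderFamily Λ N T_L T_R) x₀ (fun _ => rbUnitQ i'))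
    (h2 : InGermModule (P.rbHormanderFamily Λ N T_L T_R) x₀
      (fun y => P.bondCoeff 2 i i' y • (rbUnitP i : RBPhaseSpace N))) (k : ℕ) (hk : 2 ≤ k) :
    InGermModule (P.rbHormanderFamily Λ N T_L T_R) x₀
      (fun y => P.bondCoeff k i i' y • (rbUnitP i : RBPhaseSpace N)) := by
  induction k with
  | zero => omega
  | succ k ih =>
    rcases Nat.lt_or_ge k 2 with hlt | hge
    · have : k + 1 = 2 := by omega
      rw [this]; exact h2
    · rw [← P.lieBracket_rbUnitQ_bondCoeff_smul hV k hii']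
      exact hQ.lieBracket (P.rbHormanderFamily_smooth hU hV Λ N T_L T_R) (ih hge)

/-- **The H2 step**: from `∂_{q_{i'}}`, the `∂_{p_l}` (`l ≤ i'`) and H2 at `q_i - q_{i'}`
(`i = i' + 1`), the direction `∂_{p_i}` is in the germ module at `x₀` ("The condition H2 means
that we can write `∂_{p₂}` as a linear combination of these commutators for every `x`").
[cite: ReyBelletThomas2002, Prop 4.1] -/
theorem inGermModule_rbUnitP_succ (hV2 : RBNondegenerate P.V) {x₀ : RBPhaseSpace N}
    {i i' : Fin N} (hii' : i.val = i'.val + 1)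
    (hQ : InGermModule (P.rbHormanderFamily Λ N T_L T_R) x₀ (fun _ => rbUnitQ i'))
    (hPl : ∀ l : Fin N, l.val ≤ i'.val →
      InGermModule (P.rbHormanderFamily Λ N T_L T_R) x₀ (fun _ => rbUnitP l)) :
    InGermModule (P.rbHormanderFamily Λ N T_L T_R) x₀ (fun _ => rbUnitP i) := by
  have hne : i ≠ i' := fun e => by rw [e] at hii'; omega
  -- `Z_2`
  have h2 : InGermModule (P.rbHormanderFamily Λ N T_L T_R) x₀
      (fun y => P.bondCoeff 2 i i' y • (rbUnitP i : RBPhaseSpace N)) := by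
    have h := P.inGermModule_hess_smul_rbUnitP hU hV hii' hQ hPl
    have e : (fun y : RBPhaseSpace N => P.bondCoeff 2 i i' y • (rbUnitP i : RBPhaseSpace N)) =
        fun y => deriv (deriv P.V) (y.1.1 i - y.1.1 i') • (rbUnitP i : RBPhaseSpace N) := by
      funext y
      simp [bondCoeff, iteratedDeriv_succ, iteratedDeriv_zero]
    rwa [e]
  -- H2 at the bond
  obtain ⟨m, hm, hm0⟩ := hV2 (x₀.1.1 i - x₀.1.1 i')
  have hZ := P.inGermModule_bondCoeff_smul hU hV hne hQ h2 m hm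
  refine InGermModule.of_smul_of_ne_zero
    (Eventually.of_forall fun y => (P.contDiff_bondCoeff hV m i i').contDiffAt) ?_ hZ
  simp only [bondCoeff]
  exact mul_ne_zero (pow_ne_zero _ (by norm_num)) hm0

/-- **Rey-Bellet–Thomas 2002, Proposition 4.1, PROVED** (`d = 1`): for smooth potentials with
`V` satisfying **H2** (`RBNondegenerate`: for every `q` some derivative `V⁽ᵐ⁾(q)`, `m ≥ 2`, is
non-zero), coupling `Λ ≠ 0` and genuine reservoirs `γT_L > 0`, `γT_R > 0`, the family
`(X₀, X_L, X_R)` of the generator `L = X_L² + X_R² + X₀` of (RBT-SDE) (`rbGenerator_eq_hormanderOp`)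
satisfies Hörmander's bracket condition at every point of the extended phase space: "If H2
holds then the generator `L` given by Eq. (13) satisfies the rank condition (45)."
[cite: ReyBelletThomas2002, Prop 4.1] -/
theorem isBracketGenerating_rbHormanderFamily (hV2 : RBNondegenerate P.V) (hΛ : Λ ≠ 0)
    (hL : 0 < P.γ * T_L) (hR : 0 < P.γ * T_R) :
    IsBracketGenerating (P.rbHormanderFamily Λ N T_L T_R) univ := by
  intro x₀ _
  -- every coordinate direction is in the germ module at `x₀`, by strong induction on the site
  have key : ∀ m : ℕ, ∀ i : Fin N, i.val = m →
      InGermModule (P.rbHormanderFamily Λ N T_L T_R) x₀ (fun _ => rbUnitP i) ∧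
        InGermModule (P.rbHormanderFamily Λ N T_L T_R) x₀ (fun _ => rbUnitQ i) := by
    intro m
    induction m using Nat.strong_induction_on with
    | _ m ih =>
      intro i him
      have hPi : InGermModule (P.rbHormanderFamily Λ N T_L T_R) x₀ (fun _ => rbUnitP i) := by
        rcases Nat.eq_zero_or_pos m with hm | hm
        · exact P.inGermModule_rbUnitP_zero hU hV hΛ hL x₀ i (by omega)
        · set i' : Fin N := ⟨m - 1, by omega⟩ with hi'
          have hii' : i.val = i'.val + 1 := by simp [hi']; omega
          refine P.inGermModule_rbUnitP_succ hU hV hV2 hii' (ih i'.val (by simp [hi']; omega) i' rfl).2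
            fun l hl => (ih l.val (by simp [hi'] at hl; omega) l rfl).1
      exact ⟨hPi, P.inGermModule_rbUnitQ_of_rbUnitP hU hV hL hR hPi⟩
  refine bracketSpanAt_eq_top_of_inGermModule (span_rbUnit_eq_top N) ?_
  rintro v ((⟨i, rfl⟩ | ⟨i, rfl⟩) | (rfl | rfl))
  · exact (key _ i rfl).2
  · exact (key _ i rfl).1
  · exact P.inGermModule_rbUnitRL hL x₀
  · exact P.inGermModule_rbUnitRR hR x₀

end Brackets

end OscillatorChain

end Literature.MathematicalPhysics.KineticTheory.HeatConduction
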